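import Summits.HubbardSuperconductivity.HubbardSuperconductivity.Theses.SignStructure
import Summits.HubbardSuperconductivity.HubbardSuperconductivity.Theses.AbsenceCertificate
import Summits.HubbardSuperconductivity.HubbardSuperconductivity.Theorems.NoGoNogoThesis
import Summits.HubbardSuperconductivity.HubbardSuperconductivity.Theorems.SignStructureShadowTransfer
import Literature.MathematicalPhysics.QuantumLattice.PairCorrelationsProofs
import Literature.MathematicalPhysics.QuantumLattice.HubbardWave0PosSemidefProofs

/-!
# Census evidence (crux-strategist `cstrat-stmt-HubbardSuperconductivity-2136`): the candidate cuts of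
# `SignStructure.Target` (≡ ¬S), TYPED, with the seams / collapses that are cheap proved

`Target` = ¬HubbardSuperconductivity pushed through the quantifiers (landed iff:
`NoGo.not_hubbardSuperconductivity_iff`). This file types the alternative decompositions examined in
STRATEGY-CENSUS.md and proves the cheap implications that decide criteria (b)/(c):

* D3 regional cover (`TargetOn`, `target_of_cover`: the conjunct/case seam — route NoGo's cut);
* D4 thermal seam (`ColdShadow β`, `ThermalDWaveAbsence β`, squeeze `target_of_thermal`; and the
  collapse `coldShadow_of_targetLim`: the GS-side piece is implied by the lim-form of Target for
  EVERY schedule β, modulo positivity of Gibbs averages);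
* D6 Yang-spectral strengthening (`NoODLROAnyChannel`, typed);
* D7 energy–order inequality (`DWaveOrderCostsEnergy`, typed);
* D8 the sourced-order interface — which EXISTS as route AbsenceCertificate:
  `target_of_absenceCertificate : SourcedVanishingExcludesLRO → UniversalSourcedVanishing → Target`.
-/

set_option linter.dupNamespace false
set_option linter.unusedSectionVars false
set_option linter.unusedVariables false

noncomputable section

namespace Summit.HubbardSuperconductivity.HubbardSuperconductivity.Cruxes.Target.Census2136

open scoped Classical ComplexOrder
open Matrix Filter
open Literature.MathematicalPhysics.QuantumLattice Literature.Probability.LatticeModels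
open Summit.HubbardSuperconductivity.HubbardSuperconductivity.Theses.SignStructure
open Summit.HubbardSuperconductivity.HubbardSuperconductivity.Theorems

/-- Admissibility clause of `Target` (sector ground states at even sides, normalised). [folklore] -/
def Admissible (U δ : ℝ) (N : ℕ → ℕ) (ψ : ∀ L, Fock (Orb (FermionTorus 2 L))) : Prop :=
  ∀ L, Even L → N L = 2 * ⌊(1 - δ) * (L : ℝ) ^ 2 / 2⌋₊ ∧ star (ψ L) ⬝ᵥ ψ L = 1 ∧
    IsGroundStateInSector (hubbardTorus 2 L 1 U) (N L) 0 (ψ L)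

/-- The normalised d-wave pair functional at side `L + 1`:
`F_d(ψ_{L+1}) = re ⟨ψ, Δ_d†Δ_d ψ⟩ / (re ⟨ψ,ψ⟩ · (L+1)⁴)`. [folklore] -/
def Fd (ψ : ∀ L, Fock (Orb (FermionTorus 2 L))) (L : ℕ) : ℝ :=
  (expect ((pairField dWaveFormFactor (L + 1))ᴴ * pairField dWaveFormFactor (L + 1))
      (ψ (L + 1))).re /
    ((star (ψ (L + 1)) ⬝ᵥ ψ (L + 1)).re * ((L + 1 : ℕ) : ℝ) ^ 4)

/-- `F_d ≥ 0` (Gram numerator, nonnegative denominator; `x / 0 = 0`). [folklore] -/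
theorem Fd_nonneg (ψ : ∀ L, Fock (Orb (FermionTorus 2 L))) (L : ℕ) : 0 ≤ Fd ψ L := by
  unfold Fd
  refine div_nonneg ?_ (mul_nonneg ?_ (by positivity))
  · rw [PosSemidefTrace.expect_conjTranspose_mul, ← norm_toLp_sq_eq_re]
    positivity
  · rw [← norm_toLp_sq_eq_re]
    positivity

/-- lim-form of `Target` (as in ShadowCollapse.lean). [folklore] -/
def TargetLim : Prop :=
  ∀ U : ℝ, 0 < U → ∀ δ ∈ Set.Ioo (0:ℝ) (1/2), ∃ (N : ℕ → ℕ)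
    (ψ : ∀ L, Fock (Orb (FermionTorus 2 L))), Admissible U δ N ψ ∧
      Tendsto (fun L : ℕ => Fd ψ L) atTop (nhds 0)

/-- `TargetLim → Target`. [folklore] -/
theorem target_of_targetLim (h : TargetLim) : Target := by
  intro U hU δ hδ
  obtain ⟨N, ψ, hadm, hF⟩ := h U hU δ hδ
  refine ⟨N, ψ, hadm, not_hasLongRangeOrder_of_tendsto_zero ψ (fun j => ?_) hF⟩
  exact (hadm (2 * (j + 1)) (even_two_mul (j + 1))).2.1

/-! ## D3 — regional cover (route NoGo's cut): the conjunct seam -/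

/-- `Target` restricted to a parameter region `R ⊆ (0,∞) × (0,1/2)`. [folklore] -/
def TargetOn (R : Set (ℝ × ℝ)) : Prop :=
  ∀ U : ℝ, 0 < U → ∀ δ ∈ Set.Ioo (0:ℝ) (1/2), (U, δ) ∈ R →
    ∃ (N : ℕ → ℕ) (ψ : ∀ L, Fock (Orb (FermionTorus 2 L))), Admissible U δ N ψ ∧
      ¬ HasLongRangeOrder (fun k => halfOpenBox 2 (2 * k))
          (fun k => torusPullback (pairFieldCorr dWaveFormFactor ψ) (2 * k))

/-- The regional seam is a case split (flag `trivial_seam`): strong- and weak-coupling halves of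
any threshold curve `U₀(δ)` reassemble `Target`. [folklore] -/
theorem target_of_cover (U₀ : ℝ → ℝ) (hStrong : TargetOn {p | U₀ p.2 ≤ p.1})
    (hWeak : TargetOn {p | p.1 < U₀ p.2}) : Target := by
  intro U hU δ hδ
  rcases le_or_gt (U₀ δ) U with h | h
  · exact hStrong U hU δ hδ h
  · exact hWeak U hU δ hδ h

/-- … and conversely each half is a corollary of `Target` (strictly weaker pieces). [folklore] -/
theorem targetOn_of_target (R : Set (ℝ × ℝ)) (h : Target) : TargetOn R :=
  fun U hU δ hδ _ => h U hU δ hδ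

/-! ## D4 — thermal seam (negative mirror of route LogColdTorus) -/

/-- The d-wave pair functional of the `(N_{L+1}, S^z = 0)`-sector Gibbs state of
`hubbardTorus 2 (L+1) 1 U` at inverse temperature `β_{L+1}`, normalised by `(L+1)⁴`
(sector block as in `LogColdTorus.LogColdDWaveOrder`). [folklore] -/
def sectorGibbsFd (U δ : ℝ) (β : ℕ → ℝ) (L : ℕ) : ℝ :=
  let p : Finset (Orb (FermionTorus 2 (L + 1))) → Prop := fun s =>
    s.card = 2 * ⌊(1 - δ) * ((L + 1 : ℕ) : ℝ) ^ 2 / 2⌋₊ ∧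
      2 * (s.filter fun i => (ofLex i).2 = 0).card = 2 * ⌊(1 - δ) * ((L + 1 : ℕ) : ℝ) ^ 2 / 2⌋₊
  (Matrix.gibbsState (β (L + 1)) ((hubbardTorus 2 (L + 1) 1 U).toBlock p p)
      (((pairField dWaveFormFactor (L + 1))ᴴ * pairField dWaveFormFactor (L + 1)).toBlock p p)).re /
    ((L + 1 : ℕ) : ℝ) ^ 4

/-- K₁(β): some admissible ground-state sequence is asymptotically NO MORE d-ordered than the sector
Gibbs state along the schedule `β`. [folklore] -/
def ColdShadow (β : ℕ → ℝ) : Prop :=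
  ∀ U : ℝ, 0 < U → ∀ δ ∈ Set.Ioo (0:ℝ) (1/2), ∃ (N : ℕ → ℕ)
    (ψ : ∀ L, Fock (Orb (FermionTorus 2 L))), Admissible U δ N ψ ∧
      ∀ ε : ℝ, 0 < ε → ∀ᶠ L : ℕ in atTop, Fd ψ L ≤ sectorGibbsFd U δ β L + ε

/-- K₂(β): no thermal d-wave pair order along the schedule `β`, at every `(U, δ)`. For
`β_L |t| = o(log L)` this is the tree's Koma–Tasaki theorem
(`PositiveTemperatureNoPairLRO`, `not_hasTorusLRO_thermal_of_schedule`, grand-canonical form);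
beyond `log L` it is open and is "Target at temperature 1/β_L". [folklore] -/
def ThermalDWaveAbsence (β : ℕ → ℝ) : Prop :=
  ∀ U : ℝ, 0 < U → ∀ δ ∈ Set.Ioo (0:ℝ) (1/2),
    Tendsto (fun L : ℕ => sectorGibbsFd U δ β L) atTop (nhds 0)

/-- Squeeze: a nonnegative sequence dominated up to every `ε` by a null sequence is null. [folklore] -/
theorem tendsto_zero_of_dominated {a G : ℕ → ℝ} (ha : ∀ L, 0 ≤ a L)
    (hdom : ∀ ε : ℝ, 0 < ε → ∀ᶠ L in atTop, a L ≤ G L + ε) (hG : Tendsto G atTop (nhds 0)) :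
    Tendsto a atTop (nhds 0) := by
  rw [tendsto_order]
  refine ⟨fun b hb => Eventually.of_forall fun L => hb.trans_le (ha L), fun b hb => ?_⟩
  have h1 := hdom (b / 2) (by linarith)
  have h2 := (tendsto_order.1 hG).2 (b / 2) (by linarith)
  filter_upwards [h1, h2] with L hL1 hL2
  linarith

/-- The thermal seam (criterion (b): a genuine squeeze, ~10 lines): `K₁(β) → K₂(β) → Target`. [folklore] -/
theorem target_of_thermal (β : ℕ → ℝ) (h1 : ColdShadow β) (h2 : ThermalDWaveAbsence β) : Target := by
  refine target_of_targetLim fun U hU δ hδ => ?_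
  obtain ⟨N, ψ, hadm, hdom⟩ := h1 U hU δ hδ
  exact ⟨N, ψ, hadm, tendsto_zero_of_dominated (Fd_nonneg ψ) hdom (h2 U hU δ hδ)⟩

/-- COLLAPSE of the GS-side piece (criterion (c) in substance): for EVERY schedule `β`, `K₁(β)` is
implied outright by the lim-form of `Target` (the right-hand side is ≥ 0), here modulo the
positivity of the sector Gibbs average of the Gram operator `Δ_d†Δ_d`
(`Matrix.gibbsState_nonneg_of_posSemidef` + block bookkeeping). [folklore] -/
theorem coldShadow_of_targetLim (β : ℕ → ℝ) (hG : ∀ U δ L, 0 ≤ sectorGibbsFd U δ β L)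
    (h : TargetLim) : ColdShadow β := by
  intro U hU δ hδ
  obtain ⟨N, ψ, hadm, hF⟩ := h U hU δ hδ
  refine ⟨N, ψ, hadm, fun ε hε => ?_⟩
  filter_upwards [(tendsto_order.1 hF).2 ε hε] with L hL
  linarith [hG U δ L]

/-! ## D6 — Yang-spectral strengthening (no ODLRO in ANY channel) -/

/-- Y: some admissible sequence has `λ_max(ρ₂(ψ_{L+1})) = o(L²)` (Rayleigh form). With Yang's
bound `⟨Δ_d†Δ_d⟩ = φ_d† ρ₂ φ_d ≤ λ_max ‖φ_d‖² = 4(L+1)² λ_max` it gives `TargetLim` — a piece at least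
as strong as Target whose bridge is a known identity (`expect_pairField_eq_dotProduct_twoParticleRDM`). [folklore] -/
def NoODLROAnyChannel : Prop :=
  ∀ U : ℝ, 0 < U → ∀ δ ∈ Set.Ioo (0:ℝ) (1/2), ∃ (N : ℕ → ℕ)
    (ψ : ∀ L, Fock (Orb (FermionTorus 2 L))), Admissible U δ N ψ ∧
      ∀ ε : ℝ, 0 < ε → ∀ᶠ L : ℕ in atTop,
        ∀ v : Orb (FermionTorus 2 (L + 1)) × Orb (FermionTorus 2 (L + 1)) → ℂ,
          (star v ⬝ᵥ (twoParticleRDM (ψ (L + 1)) *ᵥ v)).re ≤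
            ε * ((L + 1 : ℕ) : ℝ) ^ 2 * (star v ⬝ᵥ v).re

/-! ## D7 — energy–order inequality (d-wave order costs energy density) -/

/-- E: at every `(U, δ)`, d-wave pair order of size `c` in a normalised sector state costs energy
density `η(c) > 0` above the sector minimum. `E → Target` is ground-state existence
(`NoGo.exists_groundStateInSector_seq`) plus minimality — a piece STRONGER than Target with a
cheap bridge. [folklore] -/
def DWaveOrderCostsEnergy : Prop :=
  ∀ U : ℝ, 0 < U → ∀ δ ∈ Set.Ioo (0:ℝ) (1/2), ∀ c : ℝ, 0 < c → ∃ η : ℝ, 0 < η ∧ ∃ L₀ : ℕ,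
    ∀ (L : ℕ) [NeZero L] (φ : Fock (Orb (FermionTorus 2 L))), L₀ ≤ L → Even L →
      φ ∈ szSector (2 * ⌊(1 - δ) * (L : ℝ) ^ 2 / 2⌋₊) 0 → star φ ⬝ᵥ φ = 1 →
      c * (L : ℝ) ^ 4 ≤ (expect ((pairField dWaveFormFactor L)ᴴ * pairField dWaveFormFactor L) φ).re →
      (hubbardTorus 2 L 1 U).minEnergyOn (szSector (2 * ⌊(1 - δ) * (L : ℝ) ^ 2 / 2⌋₊) 0) +
          η * (L : ℝ) ^ 2 ≤ (expect (hubbardTorus 2 L 1 U) φ).re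

/-! ## D8 — the sourced-order interface exists, as route AbsenceCertificate -/

open Summit.HubbardSuperconductivity.HubbardSuperconductivity.Theses.AbsenceCertificate in
/-- The tree already holds a (c)-compliant two-piece derivation of the SHARED statement ¬S ≡ Target
through an interface notion (the Koma–Tasaki sourced d-wave order parameter `dWaveSourceDensity`):
AbsenceCertificate's deciding theorem composed with the landed iff. [folklore] -/
theorem target_of_absenceCertificate (hSchema : SourcedVanishingExcludesLRO)
    (hX : UniversalSourcedVanishing) : Target :=
  (Summit.HubbardSuperconductivity.NoGo.not_hubbardSuperconductivity_iff).mp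
    (Summit.HubbardSuperconductivity.HubbardSuperconductivity.Theses.AbsenceCertificate.closes
      hSchema hX)

end Summit.HubbardSuperconductivity.HubbardSuperconductivity.Cruxes.Target.Census2136
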